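import Summits.AtomisticToContinuum.HydrodynamicLimit.Theorems.ImplosionDichotomyHydroLimitProfilewiseBandCoherenceOccupation
import HarnessLib

/-!
# `EnergyCurrentTails` ∧ (occupation form) ⇒ `CoherentSuprathermalContentVanishesW`; the equivalence modulo ECT
# (support file, `--supports stmt-AtomisticToContinuum-17372`, line `IdeatorOneSketch`, conjunct CSCV-W of `stub_inputs`)

Companion of `Theorems/ImplosionDichotomyHydroLimitProfilewiseBandCoherenceOccupation.lean` (same namespace; §0–§4 there):
crux `ImplosionDichotomy.HydroLimitProfilewiseBand` (stmt-AtomisticToContinuum-17372), line `IdeatorOneSketch`, conjunct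
`HydroLimitInBandOfHeart.CoherentSuprathermalContentVanishesW` (CSCV-W) of the registered stub `stub_inputs`.

* §5 `oneWindow_mean` — one window in mean under the true law `localGibbsLaw σ a₀ u₀ θ₀ N Φ` (`0 < σ < 1/2`): per-time cubic
  tails `≤ e` on `[s, s+w]` (ECT's currency, integrated over the window by Tonelli on the good set,
  `ClampedCurrentsDockCubicChannelPrelim.cubicTailWindow`) and the occupation-form coherence bound `≤ ε_B` give the cube-form
  bound `≤ L³ ε_B + 8e` (pathwise `sum_cohHi_le`; the possibly non-measurable occupation term is integrated last).
* §6 `coherentW_of_occupation : EnergyCurrentTails → CSOV → CSCV-W` (registered support signature). Order of choices: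
  `σ₀ = min σ₀(ECT) σ₀(CSOV) 1/2`; `K⋆` from CSOV at `t`; given `R, η, ε`: `U = sup_{[0,t]×𝕋³}‖u‖` (slab package), ECT at the
  later time `t′ ∈ (t, T)` and accuracy `ε/16` gives the level `M` (raised to `M′ = max M U` by antitonicity of the tail),
  `L = max K⋆ 2M′`, CSOV at accuracy `ε_B` with `L³ ε_B ≤ ε/2` gives `τ₀` and `N₀(τ)`; `N₀` is raised until the window
  `[s, s+w_N]`, `s ≤ t`, fits into `[0, t′]` (`w_N → 0`). Then `L³ ε_B + 8·ε/16 ≤ ε`.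
* `coherentW_iff_occupation : EnergyCurrentTails → (CSCV-W ↔ CSOV)`.

Lead `prover-line-stmt-AtomisticToContinuum-17372-c5-0` (line cycle 6).
-/

noncomputable section

open MeasureTheory Filter Set Topology
open scoped ENNReal

namespace Summit.AtomisticToContinuum.HydrodynamicLimit.Theorems.HydroLimitBandCoherenceOccupation

open Literature.MathematicalPhysics.KineticTheory Literature.Analysis.FluidPDE Literature.Analysis.FunctionSpaces
open Summit.AtomisticToContinuum.HydrodynamicLimit.Theses
open Summit.AtomisticToContinuum.HydrodynamicLimit.Theorems.HydroLimitInBandOfHeart (CoherentSuprathermalContentVanishesW)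
open Summit.AtomisticToContinuum.HydrodynamicLimit.Theorems.TransferEntropyClockCoherence
open Summit.AtomisticToContinuum.HydrodynamicLimit.Theorems.ClampedCurrentsDockCubicChannelPrelim

/-! ## §5 One window in mean under the true law -/

variable {σ : ℝ} {N : ℕ}

/-- **From a two-term pathwise bound to a bound in mean**: if a.e. `X ≤ k₃ T + k₂ B` with `k₃, k₂ ≥ 0`, `T` a.e.-measurable,
`E[ofReal T] ≤ ofReal BT` and `E[ofReal B] ≤ ofReal BB` with `BT, BB ≥ 0`, then `E[ofReal X] ≤ ofReal (k₃ BT + k₂ BB)` (the possibly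
non-measurable term `B` is integrated last, `lintegral_add_right'`). [folklore] -/
theorem lintegral_ofReal_le_of_pathwise_two {α : Type*} [MeasurableSpace α] {P : Measure α}
    {X Tl Bq : α → ℝ} {k₃ k₂ BT BB : ℝ} (hk₃ : 0 ≤ k₃) (hk₂ : 0 ≤ k₂) (hBT : 0 ≤ BT) (hBB : 0 ≤ BB)
    (hTm : AEMeasurable Tl P) (hpath : ∀ᵐ z ∂P, X z ≤ k₃ * Tl z + k₂ * Bq z)
    (hT : ∫⁻ z, ENNReal.ofReal (Tl z) ∂P ≤ ENNReal.ofReal BT) (hB : ∫⁻ z, ENNReal.ofReal (Bq z) ∂P ≤ ENNReal.ofReal BB) :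
    ∫⁻ z, ENNReal.ofReal (X z) ∂P ≤ ENNReal.ofReal (k₃ * BT + k₂ * BB) := by
  have hpt : ∀ᵐ z ∂P, ENNReal.ofReal (X z) ≤
      ENNReal.ofReal k₃ * ENNReal.ofReal (Tl z) + ENNReal.ofReal k₂ * ENNReal.ofReal (Bq z) := by
    filter_upwards [hpath] with z hz
    calc ENNReal.ofReal (X z) ≤ ENNReal.ofReal (k₃ * Tl z + k₂ * Bq z) := ENNReal.ofReal_le_ofReal hz
      _ ≤ ENNReal.ofReal (k₃ * Tl z) + ENNReal.ofReal (k₂ * Bq z) := ENNReal.ofReal_add_le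
      _ ≤ _ := by rw [ENNReal.ofReal_mul hk₃, ENNReal.ofReal_mul hk₂]
  calc ∫⁻ z, ENNReal.ofReal (X z) ∂P
      ≤ ∫⁻ z, (ENNReal.ofReal k₃ * ENNReal.ofReal (Tl z) + ENNReal.ofReal k₂ * ENNReal.ofReal (Bq z)) ∂P :=
        lintegral_mono_ae hpt
    _ = ENNReal.ofReal k₃ * ∫⁻ z, ENNReal.ofReal (Tl z) ∂P + ENNReal.ofReal k₂ * ∫⁻ z, ENNReal.ofReal (Bq z) ∂P := by
        rw [lintegral_add_left' (hTm.ennreal_ofReal.const_mul _), lintegral_const_mul'' _ hTm.ennreal_ofReal,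
          lintegral_const_mul' _ _ ENNReal.ofReal_ne_top]
    _ ≤ ENNReal.ofReal k₃ * ENNReal.ofReal BT + ENNReal.ofReal k₂ * ENNReal.ofReal BB := by gcongr
    _ = ENNReal.ofReal (k₃ * BT + k₂ * BB) := by
        rw [← ENNReal.ofReal_mul hk₃, ← ENNReal.ofReal_mul hk₂,
          ← ENNReal.ofReal_add (mul_nonneg hk₃ hBT) (mul_nonneg hk₂ hBB)]

variable {a₀ θ₀ : T3 → ℝ} {u₀ : T3 → V3}

/-- **One window in mean.** Under the true law `P = localGibbsLaw σ a₀ u₀ θ₀ N Φ` (`0 < σ < 1/2`), for a continuous velocity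
slice `uu` with `‖uu‖ ≤ U ≤ M`, levels `K ≤ L`, `2M ≤ L`, `0 ≤ L`, a window `w > 0`, any radial weight `Rw` and coherence
level `η`: per-time cubic tails `≤ e` on `[s, s+w]` (ECT's currency) and the occupation-form coherence bound `≤ εB` give the
cube-form coherence bound `≤ L³ εB + 8 e` (pathwise `sum_cohHi_le` on the good set, Tonelli `cubicTailWindow` for the tail,
the occupation term integrated last). [folklore] -/
theorem oneWindow_mean (Φ : HardSphereFlow (Torus.geometry (Fin 3)) (hsDiameter σ N) (N + 1))
    (hσ : 0 < σ) (hσ2 : σ < 1 / 2) (ha : Continuous a₀) (hθ : Continuous θ₀) (hu : Continuous u₀)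
    (ha0 : ∀ x, 0 < a₀ x) (hθ0 : ∀ x, 0 < θ₀ x)
    {uu : T3 → V3} (huc : Continuous uu) {U M L K η s w e εB : ℝ} (hule : ∀ x, ‖uu x‖ ≤ U) (hUM : U ≤ M)
    (hML : 2 * M ≤ L) (hKL : K ≤ L) (hL : 0 ≤ L) (hw : 0 < w) (he : 0 ≤ e) (hεB : 0 ≤ εB) (Rw : T3 → ℝ → ℝ)
    (htail : ∀ r ∈ Icc s (s + w), ∫⁻ z, ENNReal.ofReal (((N : ℝ) + 1)⁻¹ * ∑ i : Fin (N + 1),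
        Set.indicator {v : V3 | M < ‖v‖} (fun v => ‖v‖ ^ 3) ((Φ.flow r z i).2)) ∂(localGibbsLaw σ a₀ u₀ θ₀ N Φ) ≤
        ENNReal.ofReal e)
    (hocc : ∫⁻ z, ENNReal.ofReal (((N : ℝ) + 1)⁻¹ * ∑ i : Fin (N + 1),
        (if η * (w⁻¹ * ∫ r in s..(s + w), ‖(Φ.flow r z i).2 - uu (Φ.flow r z i).1‖ ^ 3) <
            ‖w⁻¹ • ∫ r in s..(s + w), (Rw (Φ.flow r z i).1 (‖(Φ.flow r z i).2 - uu (Φ.flow r z i).1‖ ^ 2)) •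
              ((Φ.flow r z i).2 - uu (Φ.flow r z i).1)‖ then
          w⁻¹ * ∫ r in s..(s + w), (if K < ‖(Φ.flow r z i).2 - uu (Φ.flow r z i).1‖ then (1 : ℝ) else 0)
          else 0)) ∂(localGibbsLaw σ a₀ u₀ θ₀ N Φ) ≤ ENNReal.ofReal εB) :
    ∫⁻ z, ENNReal.ofReal (((N : ℝ) + 1)⁻¹ * ∑ i : Fin (N + 1),
        (if η * (w⁻¹ * ∫ r in s..(s + w), ‖(Φ.flow r z i).2 - uu (Φ.flow r z i).1‖ ^ 3) <
            ‖w⁻¹ • ∫ r in s..(s + w), (Rw (Φ.flow r z i).1 (‖(Φ.flow r z i).2 - uu (Φ.flow r z i).1‖ ^ 2)) •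
              ((Φ.flow r z i).2 - uu (Φ.flow r z i).1)‖ then
          w⁻¹ * ∫ r in s..(s + w), (if K < ‖(Φ.flow r z i).2 - uu (Φ.flow r z i).1‖ then
            ‖(Φ.flow r z i).2 - uu (Φ.flow r z i).1‖ ^ 3 else (0 : ℝ))
          else 0)) ∂(localGibbsLaw σ a₀ u₀ θ₀ N Φ) ≤ ENNReal.ofReal (L ^ 3 * εB + 8 * e) := by
  have hN : (0 : ℝ) < (N : ℝ) + 1 := by positivity
  have hgood := ae_mem_good_localGibbsLaw σ a₀ u₀ θ₀ N Φ
  have hgood' : (localGibbsLaw σ a₀ u₀ θ₀ N Φ) Φ.goodᶜ = 0 := mem_ae_iff.1 hgood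
  -- the tail window functional is a.e.-measurable; its mean is ECT's by Tonelli on the good set
  have hTm : AEMeasurable (fun z => ∫ r in s..(s + w), ∑ i : Fin (N + 1),
      Set.indicator {v : V3 | M < ‖v‖} (fun v => ‖v‖ ^ 3) ((Φ.flow r z i).2)) (localGibbsLaw σ a₀ u₀ θ₀ N Φ) :=
    Φ.aemeasurable_intervalIntegral_comp_flow_torus (f := tailSum N M) (measurable_tailSum N M) s (s + w) hgood'
  have hT := cubicTailWindow σ N Φ a₀ θ₀ u₀ M e s w hσ hσ2 ha hθ hu ha0 hθ0 he hw.le htail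
  have hk₃ : 0 ≤ 8 * ((N : ℝ) + 1)⁻¹ * w⁻¹ := by positivity
  refine (lintegral_ofReal_le_of_pathwise_two hk₃ (pow_nonneg hL 3) (by positivity : 0 ≤ w * ((N : ℝ) + 1) * e)
    hεB hTm ?_ hT hocc).trans (le_of_eq ?_)
  · -- the pathwise bound on the good set
    filter_upwards [hgood] with z hz
    have key := sum_cohHi_le Φ hz huc hule hUM hML hKL hL hw.le
      (fun i => η * (w⁻¹ * ∫ r in s..(s + w), ‖(Φ.flow r z i).2 - uu (Φ.flow r z i).1‖ ^ 3))
      (fun i => ‖w⁻¹ • ∫ r in s..(s + w), (Rw (Φ.flow r z i).1 (‖(Φ.flow r z i).2 - uu (Φ.flow r z i).1‖ ^ 2)) •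
        ((Φ.flow r z i).2 - uu (Φ.flow r z i).1)‖) (K := K) (s := s)
    have h2 := mul_le_mul_of_nonneg_left key (inv_nonneg.2 hN.le)
    refine h2.trans (le_of_eq ?_)
    ring
  · congr 1
    field_simp
    ring
/-! ## §6 ECT ∧ CSOV ⇒ CSCV-W, and the equivalence modulo ECT -/

/-- **ECT ∧ CSOV ⇒ CSCV-W.** Order of choices: `σ₀ = min σ₀(ECT) σ₀(CSOV) 1/2`; `K⋆` from CSOV at `t`; given `R, η, ε`:
`U = sup_{[0,t]×𝕋³} ‖u‖` (slab package), ECT at the later time `t′ = (t+T)/2` and accuracy `ε/16` gives the level `M`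
(raised to `M′ = max M U`, antitonicity of the tail), `L = max K⋆ 2M′`, CSOV at accuracy `ε_B = ε/(2(L³+1))` gives `τ₀` and
`N₀(τ)`; `N₀` is raised until the window `[s, s+w_N]`, `s ≤ t`, fits into `[0, t′]`. Then `oneWindow_mean`:
`L³ ε_B + 8 ε/16 ≤ ε`. [folklore] -/
theorem coherentW_of_occupation :
    OneFlightGossipEngine.EnergyCurrentTails → CoherentSuprathermalOccupationVanishes → CoherentSuprathermalContentVanishesW := by
  intro hECT hOcc a₀ θ₀ u₀ ha hθ hu ha0 hθ0
  obtain ⟨σE, hσE, HE⟩ := hECT a₀ θ₀ u₀ ha hθ hu ha0 hθ0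
  obtain ⟨σB, hσB, HB⟩ := hOcc a₀ θ₀ u₀ ha hθ hu ha0 hθ0
  refine ⟨min (min σE σB) (1 / 2), lt_min (lt_min hσE hσB) (by norm_num), ?_⟩
  intro σ hσ hσlt T ρ θ u hE Φ htie t ht
  have hσE' : σ < σE := hσlt.trans_le ((min_le_left _ _).trans (min_le_left _ _))
  have hσB' : σ < σB := hσlt.trans_le ((min_le_left _ _).trans (min_le_right _ _))
  have hσ2 : σ < 1 / 2 := hσlt.trans_le (min_le_right _ _)
  obtain ⟨K, hK, HK⟩ := HB σ hσ hσB' T ρ θ u hE Φ htie t ht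
  refine ⟨K, hK, ?_⟩
  intro R hRm hR0 hR η hη ε hε
  -- the Euler velocity is bounded on the slab `[0, t] × 𝕋³`
  obtain ⟨θM, U, Bb, Lb, -, hU, -, -, hslab⟩ := slab_package hE ht
  -- ECT at a later time `t'`, accuracy `ε/16`
  obtain ⟨t', htt', ht'T⟩ : ∃ t' : ℝ, t < t' ∧ t' < T := ⟨(t + T) / 2, by linarith [ht.2], by linarith [ht.2]⟩
  have ht' : t' ∈ Ico 0 T := ⟨ht.1.trans htt'.le, ht'T⟩
  obtain ⟨M, N₁, HM⟩ := HE σ hσ hσE' T ρ θ u hE Φ htie t' ht' (ε / 16) (by positivity)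
  -- levels
  obtain ⟨M', hMM', hUM', hM'0⟩ : ∃ M' : ℝ, M ≤ M' ∧ U ≤ M' ∧ 0 ≤ M' :=
    ⟨max M U, le_max_left _ _, le_max_right _ _, hU.trans (le_max_right _ _)⟩
  obtain ⟨L, hKL, hML, hL0⟩ : ∃ L : ℝ, K ≤ L ∧ 2 * M' ≤ L ∧ 0 ≤ L :=
    ⟨max K (2 * M'), le_max_left _ _, le_max_right _ _, hK.le.trans (le_max_left _ _)⟩
  obtain ⟨εB, hεB, hεBle⟩ : ∃ εB : ℝ, 0 < εB ∧ L ^ 3 * εB ≤ ε / 2 := by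
    refine ⟨ε / (2 * (L ^ 3 + 1)), by positivity, ?_⟩
    rw [mul_div_assoc', div_le_div_iff₀ (by positivity) (by positivity)]
    nlinarith [pow_nonneg hL0 3, hε.le]
  -- the occupation input
  obtain ⟨τ₀, hτ₀, Hτ⟩ := HK R hRm hR0 hR η hη εB hεB
  refine ⟨τ₀, hτ₀, fun τ hτ => ?_⟩
  obtain ⟨N₂, HN₂⟩ := Hτ τ hτ
  -- the window fits into `[0, t']` for `N` large
  obtain ⟨N₃, HN₃⟩ : ∃ N₃ : ℕ, ∀ N : ℕ, N₃ ≤ N → τ * ((N : ℝ) + 1) ^ (-(1 / 3 : ℝ)) ≤ t' - t :=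
    Filter.eventually_atTop.1 ((tendsto_window_zero τ).eventually (ge_mem_nhds (sub_pos.2 htt')))
  refine ⟨max N₁ (max N₂ N₃), fun N hN s hs => ?_⟩
  have hN₁ : N₁ ≤ N := (le_max_left _ _).trans hN
  have hN₂ : N₂ ≤ N := ((le_max_left _ _).trans (le_max_right _ _)).trans hN
  have hN₃ : N₃ ≤ N := ((le_max_right _ _).trans (le_max_right _ _)).trans hN
  have Hocc := HN₂ N hN₂ s hs
  dsimp only at Hocc ⊢
  have hw : 0 < τ * ((N : ℝ) + 1) ^ (-(1 / 3 : ℝ)) :=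
    mul_pos (hτ₀.trans_le hτ) (Real.rpow_pos_of_pos (by positivity) _)
  obtain ⟨-, husc, -, -, -, hule, -, -⟩ := hslab s hs
  -- per-time cubic tails on the window, from ECT at the times `r ∈ [s, s + w] ⊂ [0, t']`
  have htail : ∀ r ∈ Icc s (s + τ * ((N : ℝ) + 1) ^ (-(1 / 3 : ℝ))), ∫⁻ z, ENNReal.ofReal (((N : ℝ) + 1)⁻¹ *
      ∑ i : Fin (N + 1), Set.indicator {v : V3 | M' < ‖v‖} (fun v => ‖v‖ ^ 3) (((Φ N).flow r z i).2))
        ∂(localGibbsLaw σ a₀ u₀ θ₀ N (Φ N)) ≤ ENNReal.ofReal (ε / 16) := by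
    intro r hr
    have hr' : r ∈ Icc 0 t' := ⟨hs.1.trans hr.1, hr.2.trans (by linarith [HN₃ N hN₃, hs.2])⟩
    exact (lintegral_tail_mono (Φ N) _ hMM' r).trans (HM N hN₁ r hr')
  refine (oneWindow_mean (Φ N) hσ hσ2 ha hθ hu ha0 hθ0 husc hule hUM' hML hKL hL0 hw
    (by positivity : (0 : ℝ) ≤ ε / 16) hεB.le (R s) htail Hocc).trans (ENNReal.ofReal_le_ofReal ?_)
  linarith

/-- **MODULO ECT, THE COHERENCE INPUT IS ITS OCCUPATION FORM**: given `EnergyCurrentTails` (board item stmt-9235, itself a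
conjunct of the same registered stub `stub_inputs`), `CoherentSuprathermalContentVanishesW ↔
CoherentSuprathermalOccupationVanishes` — the suprathermal cube in CSCV-W carries no content beyond ECT; what is open is the
rarity, in window occupation measure, of direction-coherent suprathermal excursions under the true pre-shock law. [folklore] -/
theorem coherentW_iff_occupation :
    OneFlightGossipEngine.EnergyCurrentTails → (CoherentSuprathermalContentVanishesW ↔ CoherentSuprathermalOccupationVanishes) :=
  fun hECT => ⟨occupation_of_coherentW, coherentW_of_occupation hECT⟩

end Summit.AtomisticToContinuum.HydrodynamicLimit.Theorems.HydroLimitBandCoherenceOccupation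

end
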